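import Summits.Ventures.CertifiedManyBodySolver.Downfold.RouterWordScore

/-!
# The v8 slate M227–M254: score-2's pre-registered router-word readings (PREREG §E by-reference to Y87,
# 2026-08-27T13:5xZ) as kernel facts of the §4.2 score — and the one structural lemma behind them

Venture CertifiedManyBodySolver, cell `pub/hubbard-downfold`, seat hubbard-downfold-score-2 (g12); namespace
`Summit.Ventures.CertifiedManyBodySolver.Downfold.RouterScore` (REUSES `score`, `Head`, `Outcome`, `outcome`, `primaryEmitted` of
`RouterWordScore.lean`, the three-way-tested kernel form of ACCEPTANCE §4.2). Context: validation-set tranche v8 grew to M254 on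
2026-08-27 (β-pyrochlore osmates, Ni-pnictide e–ph controls of the Fe-pnictide family, Pd/Pt/Nb intermetallics, Fe chalcogenides,
the AgF₂ cuprate-analogue control, Ca₂RuO₄, CeIrIn₅, n-SrTiO₃, Bi/sp metals) with EXPECTED router words typed by the curators before
any descriptor run. score-2 registered BY REFERENCE (PREREG Y87's letter) what every plausible print SCORES, and PRE-NAMED the at-risk
print shape per class, BEFORE any word on these rows existed (python engine `router_score.py score <id> <P> <word>`, all cases
below checked there first). §1 is the general lemma those readings lean on: an emitted word that CONTAINS some alternative's primary
can never score `DISAGREE` (the converse of `primary_emitted_of_not_disagree`); §2 are the class readings as `decide` theorems.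

WHAT THIS IS NOT: not a word, not a prediction that any material prints these words, not a score of record (the v8 table is cut
once at the lead's «v8 CLOSE» into ROUTER-SCORES-v8.tsv, never pooled with R), and not physics. Material names appear only in
docstrings; `UND:DISORDER` is an open-grammar head written `other 0` as in `RouterScoreAggregate.lean`.
-/

namespace Summit.Ventures.CertifiedManyBodySolver.Downfold

namespace RouterScore

/-! ## §1 An emitted expected primary excludes `DISAGREE` -/

section lemma_

variable {α : Type*} [DecidableEq α] (structural : α → Bool)

/-- If some registered alternative's PRIMARY occurs anywhere in a nonempty emitted word, the §4.2 score is not `DISAGREE`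
(it is `ABSTAIN_structure`, `AGREE` or `PARTIAL` according to the earlier clauses). This is the letter behind every
pre-registered reading of the form «typed head present as a companion ⇒ PARTIAL, never DISAGREE». [folklore] -/
theorem outcome_ne_disagree_of_primaryEmitted {p : α} {tl : List α} {alts : List (List α)}
    (h : ∃ a ∈ alts, primaryEmitted (p :: tl) a = true) :
    outcome structural (p :: tl) alts ≠ .DISAGREE := by
  obtain ⟨a, ha, hpa⟩ := h
  have halts : alts ≠ [] := List.ne_nil_of_mem ha
  have hany : alts.any (primaryEmitted (p :: tl)) = true := List.any_eq_true.mpr ⟨a, ha, hpa⟩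
  rw [outcome_cons, if_neg halts]
  by_cases hg : (structural p && !expectsStructural structural alts) = true
  · rw [if_pos hg]; decide
  rw [if_neg hg]
  by_cases hm : alts.any (fullMatch (p :: tl)) = true
  · rw [if_pos hm]; decide
  rw [if_neg hm, if_pos hany]; decide

end lemma_

open Head

/-- Specialisation used by every «EPH»-typed v8 row (Pd/Pt/Nb intermetallics, Ni-pnictides, sp/Bi metals, hydrides): a word
that carries the `EPH` token anywhere never scores `DISAGREE` against the singleton expectation «EPH». [folklore] -/
theorem score_ne_disagree_of_eph_mem (e : List Head) (h : eph ∈ e) : score e [[eph]] ≠ .DISAGREE := by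
  cases e with
  | nil => exact absurd h (by simp)
  | cons p tl =>
    exact outcome_ne_disagree_of_primaryEmitted Head.structural
      ⟨[eph], by simp, by unfold primaryEmitted; simpa using h⟩

/-! ## §2 The v8 class readings (PREREG §E 2026-08-27T13:5xZ, by reference to Y87) -/

/-- (a) β-pyrochlore osmates M227 RbOs₂O₆ / M228 CsOs₂O₆, typed «EPH | UND:MULTIORB+EPH»: the PRE-NAMED at-risk print
(the KOs₂O₆ shape) «UND:MIXED+EPH» ⇒ PARTIAL; «UND:MULTIORB(…)+EPH» and «EPH(+SA)» ⇒ AGREE; «UND:MULTIORB(…)» without the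
EPH companion ⇒ PARTIAL. [folklore] -/
theorem v8_os_pyrochlore : score [undMixed, eph] [[eph], [undMultiorb, eph]] = .PARTIAL
    ∧ score [undMultiorb, eph] [[eph], [undMultiorb, eph]] = .AGREE ∧ score [eph, sa] [[eph], [undMultiorb, eph]] = .AGREE
    ∧ score [undMultiorb] [[eph], [undMultiorb, eph]] = .PARTIAL := by decide

/-- (b) Ni-pnictide e–ph controls M246 SrNi₂As₂ / M254 LaNiPO (typed «EPH») and M253 BaNi₂As₂ («EPH | EPH+UND:STRUCT»): the
PRE-NAMED at-risk prints — the Fe-pnictide machinery on Ni-3d «UND:MULTIORB(k=5; J_H)+EPH» or a straddle «UND:MIXED+EPH» ⇒ PARTIAL;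
«EPH» ⇒ AGREE; on M253 an «UND:STRUCT…» PRIMARY ⇒ ABSTAIN_structure while «EPH+UND:STRUCT» ⇒ AGREE. [folklore] -/
theorem v8_ni_pnictide : score [undMultiorb, eph] [[eph]] = .PARTIAL ∧ score [undMixed, eph] [[eph]] = .PARTIAL
    ∧ score [eph] [[eph]] = .AGREE ∧ score [undStruct, eph] [[eph], [eph, undStruct]] = .ABSTAIN_structure
    ∧ score [eph, undStruct] [[eph], [eph, undStruct]] = .AGREE := by decide

/-- (c) 4d/5d intermetallics typed «EPH» (M231–M233 (Y/Lu/Sc)Pd₂Sn, M248 SrPt₃P ×3, M249 CaPt₃P, M250 LaPt₃P, M251 Nb₃Sb,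
M234 Mg₄Pt₃H₆ ×2): the PRE-NAMED R3c-straddle print «UND:MIXED+EPH» ⇒ PARTIAL; «EPH(+SA)» ⇒ AGREE; a structural primary
«UND:STRUCT+UND:MIXED+EPH» ⇒ ABSTAIN_structure. [folklore] -/
theorem v8_dmetal_eph : score [undMixed, eph] [[eph]] = .PARTIAL ∧ score [eph, sa] [[eph]] = .AGREE
    ∧ score [undStruct, undMixed, eph] [[eph]] = .ABSTAIN_structure := by decide

/-- (d) Fe-based rows typed «UND:MULTIORB+EPH | UND:MULTIORB» (M235 FeS, M242 FeSe₀.₅₇Te₀.₄₃, M247 Sr₂VO₃FeAs): «UND:MULTIORB(…)»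
with or without EPH ⇒ AGREE; a second, site-tagged MULTIORB token (the V site of Sr₂VO₃FeAs) never hurts; the PRE-NAMED
moment-straddle composite head «UND:MIXED(m…)+EPH+UND:MULTIORB(…)» ⇒ PARTIAL; «EPH» alone ⇒ DISAGREE. [folklore] -/
theorem v8_fe_based : score [undMultiorb, eph] [[undMultiorb, eph], [undMultiorb]] = .AGREE
    ∧ score [undMultiorb] [[undMultiorb, eph], [undMultiorb]] = .AGREE
    ∧ score [undMultiorb, eph, undMultiorb] [[undMultiorb, eph], [undMultiorb]] = .AGREE
    ∧ score [undMixed, eph, undMultiorb] [[undMultiorb, eph], [undMultiorb]] = .PARTIAL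
    ∧ score [eph] [[undMultiorb, eph], [undMultiorb]] = .DISAGREE := by decide

/-- (e) M237 CaFe₂As₂ @0/@0.63, typed «UND:MULTIORB+EPH | UND:MULTIORB | UND:MULTIORB+UND:STRUCT»: «UND:MULTIORB(…)+EPH» and
«UND:MULTIORB(…)+UND:STRUCT» ⇒ AGREE; an «UND:STRUCT…» PRIMARY at the collapsed-tetragonal boundary ⇒ ABSTAIN_structure
(UND:STRUCT is typed only as a secondary); the moment-straddle composite head ⇒ PARTIAL. [folklore] -/
theorem v8_cafe2as2 : score [undMultiorb, eph] [[undMultiorb, eph], [undMultiorb], [undMultiorb, undStruct]] = .AGREE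
    ∧ score [undMultiorb, undStruct] [[undMultiorb, eph], [undMultiorb], [undMultiorb, undStruct]] = .AGREE
    ∧ score [undStruct, undMultiorb, eph] [[undMultiorb, eph], [undMultiorb], [undMultiorb, undStruct]] = .ABSTAIN_structure
    ∧ score [undMixed, eph, undMultiorb] [[undMultiorb, eph], [undMultiorb], [undMultiorb, undStruct]] = .PARTIAL := by
  decide

/-- (f) M240 BaCo122-x0.184 (known-nonSC), typed «UND:MULTIORB+UND:DISORDER+EPH | UND:MULTIORB+EPH | UND:MULTIORB»
(`UND:DISORDER` = `other 0`): «UND:MULTIORB(…)+EPH(+UND:DISORDER)» ⇒ AGREE; the PRE-NAMED moment-collapse print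
«UND:MIXED(m…)+EPH+UND:MULTIORB» ⇒ PARTIAL; «EPH» alone ⇒ DISAGREE. [folklore] -/
theorem v8_baco122_overdoped : score [undMultiorb, eph, other 0] [[undMultiorb, other 0, eph], [undMultiorb, eph], [undMultiorb]] = .AGREE
    ∧ score [undMultiorb, eph] [[undMultiorb, other 0, eph], [undMultiorb, eph], [undMultiorb]] = .AGREE
    ∧ score [undMixed, eph, undMultiorb] [[undMultiorb, other 0, eph], [undMultiorb, eph], [undMultiorb]] = .PARTIAL
    ∧ score [eph] [[undMultiorb, other 0, eph], [undMultiorb, eph], [undMultiorb]] = .DISAGREE := by decide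

/-- (g) M245 AgF₂, the cuprate-analogue CONTROL, typed «1BH+3BE+CI | 1BH+CI»: typed prints (with or without an extra
UND:LATTICE token) ⇒ AGREE; the PRE-NAMED misses «1BH+3BE» WITHOUT the CI token ⇒ PARTIAL and the U-school-straddle
composite «UND:MIXED+1BH+3BE+EPH+CI» ⇒ PARTIAL. [folklore] -/
theorem v8_agf2 : score [bh1, be3, ci] [[bh1, be3, ci], [bh1, ci]] = .AGREE
    ∧ score [bh1, ci, undLattice] [[bh1, be3, ci], [bh1, ci]] = .AGREE
    ∧ score [bh1, be3] [[bh1, be3, ci], [bh1, ci]] = .PARTIAL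
    ∧ score [undMixed, bh1, be3, eph, ci] [[bh1, be3, ci], [bh1, ci]] = .PARTIAL := by decide

/-- (h) M229 Ca₂RuO₄ (known-nonSC Mott insulator), typed «UND:MULTIORB»: «UND:MULTIORB(k=3; J_H)(+EPH)(+CI)» ⇒ AGREE; an
«UND:MIXED(…)» head with the MULTIORB token riding ⇒ PARTIAL; a cuprate-style «1BH+3BE» ⇒ DISAGREE. [folklore] -/
theorem v8_ca2ruo4 : score [undMultiorb, eph] [[undMultiorb]] = .AGREE ∧ score [undMultiorb, eph, ci] [[undMultiorb]] = .AGREE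
    ∧ score [undMixed, undMultiorb] [[undMultiorb]] = .PARTIAL ∧ score [bh1, be3] [[undMultiorb]] = .DISAGREE := by decide

/-- (i) M236 CeIrIn₅ @0/@1.6, typed «UND:HF»: «UND:HF(…)» ⇒ AGREE; a non-HF primary with UND:HF riding ⇒ PARTIAL; «EPH» ⇒
DISAGREE (the honesty test). [folklore] -/
theorem v8_ceirin5 : score [undHF] [[undHF]] = .AGREE ∧ score [undMixed, undHF] [[undHF]] = .PARTIAL
    ∧ score [eph] [[undHF]] = .DISAGREE := by decide

/-- (j) M244 SrTiO₃-Nb, typed «EPH | EPH+UND:STRUCT»: the PRE-NAMED Ti-t2g D3-straddle print «UND:MIXED+EPH» ⇒ PARTIAL; an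
«UND:STRUCT+EPH» PRIMARY (the AFD-tetragonal cell as the head) ⇒ ABSTAIN_structure; «EPH+UND:STRUCT» ⇒ AGREE. [folklore] -/
theorem v8_srtio3_nb : score [undMixed, eph] [[eph], [eph, undStruct]] = .PARTIAL
    ∧ score [undStruct, eph] [[eph], [eph, undStruct]] = .ABSTAIN_structure
    ∧ score [eph, undStruct] [[eph], [eph, undStruct]] = .AGREE := by decide

/-- (k) M239 PbTe-Na (known-nonSC dilute control), typed «EPH» (`UND:DISORDER` = `other 0`): «EPH+UND:DISORDER» ⇒ AGREE; an
«UND:DISORDER» PRIMARY with EPH riding ⇒ PARTIAL (an open-grammar head is not structural, so no abstention). [folklore] -/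
theorem v8_pbte_na : score [eph, other 0] [[eph]] = .AGREE ∧ score [other 0, eph] [[eph]] = .PARTIAL := by decide

end RouterScore

end Summit.Ventures.CertifiedManyBodySolver.Downfold
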